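import Summits.SmoothPoincare4.SmoothPoincare4.Theorems.SymplecticOrigamiGromovRecognitionRelEndSphereWedgeCountPos
import Summits.SmoothPoincare4.SmoothPoincare4.Theorems.SymplecticOrigamiGromovRecognitionRelEndSphereWedgeZerosFinite
import Summits.SmoothPoincare4.SmoothPoincare4.Theorems.SymplecticOrigamiGromovRecognitionRelEndHolCoordCompJHol
import Summits.SmoothPoincare4.SmoothPoincare4.Theorems.SymplecticOrigamiGromovRecognitionRelEndMeromorphicOrderCompInv
import Mathlib.Analysis.Meromorphic.Order
import Mathlib.Analysis.Analytic.Order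
import Mathlib.Algebra.Order.BigOperators.Group.Finset

/-!
# A `JX`-sphere of intersection count one meets the sphere at infinity in a single simple point
(registered helper `helper_countOneStructure` of line `cross-cap-laurent`, crux
`GromovRecognitionRelEnd`, item stmt-SmoothPoincare4-11009)

Setting: `X` is a `C^∞` real `4`-manifold with a family of tangent-space endomorphisms `JX`,
`U ⊆ X` is open and `T : X → ℂ` is `C^∞` and `JX`-holomorphic on `U` (`dT (JX w) = i · dT w`),
with `H∞ = {y ∈ U | T y = 0}` closed in `X` (the "sphere at infinity" of a wedge cap).  A
`JX`-holomorphic sphere is given in two-chart form: `C^∞` maps `u v : ℂ → X`, both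
`J`-holomorphic (`Literature.Geometry.Symplectic.IsJHolomorphic`), with `v w = u w⁻¹` for `w ≠ 0`,
and the sphere is not contained in `H∞` (some `u z ∉ H∞`).  Its intersection count with `H∞` is
the sum of the orders of the zeros of the holomorphic function `f = T ∘ u` over the (finite,
`helper_sphereWedgeZerosFinite`) set `Z = {z | u z ∈ H∞}`, plus the order of `g = T ∘ v` at
`w = 0` if the point at infinity `v 0` lies on `H∞`.

Claim: if this count equals `1`, then EITHER `Z = {z₀}` is a single point, `v 0 ∉ H∞`, and `f`
has a simple zero at `z₀` (`deriv f z₀ ≠ 0`), OR `Z = ∅`, `v 0 ∈ H∞` and `g` has a simple zero at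
`0` (`deriv g 0 ≠ 0`).

Proof.  Every summand is `≥ 1`: at a point of `Z` (resp. at `0` when `v 0 ∈ H∞`) the function `f`
(resp. `g`) is analytic (`helper_holCoordCompJHol`), vanishes, and does not vanish identically
nearby (`interior_zeroSet_eq_empty`, `eventually_ne_zero_of_interior_zeroSet_eq_empty`; for `g`,
transporting an identically vanishing germ through `v w = u w⁻¹` would make the finite set `Z`
contain a neighbourhood of infinity), so `one_le_untop₀_meromorphicOrderAt_of_eventually_ne_zero`
applies.  Hence the `u`-sum dominates `#Z` (`finsum_mem_eq_finite_toFinset_sum`,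
`Finset.card_nsmul_le_sum`) and the `v`-sum is `0` or a single term `≥ 1`; a total of `1` forces
(`#Z = 1`, the single order `= 1`, `v 0 ∉ H∞`) or (`Z = ∅`, `v 0 ∈ H∞`, order of `g` at `0`
equal to `1`).  Finally an analytic germ of meromorphic order `1` has analytic order `1`
(`AnalyticAt.meromorphicOrderAt_eq`), so its derivative has analytic order `0`
(`analyticOrderAt_deriv_of_pos`), i.e. does not vanish (`AnalyticAt.analyticOrderAt_eq_zero`).

References: principle of isolated zeros and orders of zeros (Mathlib
`Mathlib.Analysis.Analytic.Order`, `Mathlib.Analysis.Meromorphic.Order`); D. McDuff, D. Salamon,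
*J-holomorphic Curves and Symplectic Topology*, 2nd ed. (2012), §2.6 and App. E (local
intersection numbers of `J`-curves with `J`-hypersurfaces are positive, and equal to `1` exactly at
transverse intersections).  No new definitions, notation or instances.
-/

noncomputable section

-- the prescribed namespace `Summit.<P>.<Sub>.…` duplicates `SmoothPoincare4` (P = Sub)
set_option linter.dupNamespace false

open scoped Manifold ContDiff Topology
open Set Function Filter Bornology
open Literature.Geometry.Symplectic

namespace Summit.SmoothPoincare4.SmoothPoincare4.Theorems.GromovRecognitionRelEnd.CrossCapLaurent

/-- **A zero of meromorphic order one is simple.** If `f` is analytic at `z₀` and its meromorphic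
order there, read in `ℤ` via `WithTop.untop₀`, equals `1`, then `deriv f z₀ ≠ 0`: the meromorphic
order is the analytic order (`AnalyticAt.meromorphicOrderAt_eq`), so the analytic order is `1`, the
derivative has analytic order `0` (`analyticOrderAt_deriv_of_pos`) and therefore does not vanish at
`z₀` (`AnalyticAt.analyticOrderAt_eq_zero`). -/
theorem deriv_ne_zero_of_untop₀_meromorphicOrderAt_eq_one {f : ℂ → ℂ} {z₀ : ℂ}
    (hf : AnalyticAt ℂ f z₀) (h1 : (meromorphicOrderAt f z₀).untop₀ = 1) : deriv f z₀ ≠ 0 := by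
  -- the analytic order of `f` at `z₀` is `1`
  have hA : analyticOrderAt f z₀ = (0 : ℕ) + 1 := by
    rw [hf.meromorphicOrderAt_eq] at h1
    cases hn : analyticOrderAt f z₀ with
    | top =>
      rw [hn, ENat.map_top, WithTop.untop₀_top] at h1
      exact absurd h1 zero_ne_one
    | coe n =>
      rw [hn, ENat.map_coe, WithTop.untop₀_coe] at h1
      have hn1 : n = 1 := by exact_mod_cast h1
      rw [hn1]
      norm_num
  -- hence the derivative has analytic order `0`, i.e. does not vanish
  have hd : analyticOrderAt (deriv f) z₀ = (0 : ℕ) := analyticOrderAt_deriv_of_pos hf hA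
  exact hf.deriv.analyticOrderAt_eq_zero.mp (by simpa using hd)

/-- **A sphere of intersection count one meets the sphere at infinity in exactly one simple
point.**  For `U ⊆ X` open, `T : X → ℂ` smooth and `JX`-holomorphic on `U` with
`H∞ = {y ∈ U | T y = 0}` closed, and a `JX`-holomorphic sphere in two-chart form `u, v : ℂ → X`
(`C^∞`, `J`-holomorphic, `v w = u w⁻¹` for `w ≠ 0`) with some `u z ∉ H∞`: if the count
`Σ_{u z ∈ H∞} ord_z (T ∘ u) + [v 0 ∈ H∞] · ord_0 (T ∘ v)` equals `1`, then either there is exactly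
one parameter `z₀` with `u z₀ ∈ H∞`, the point at infinity `v 0` is off `H∞`, and `T ∘ u` has a
simple zero at `z₀`; or no `u z` lies on `H∞`, `v 0 ∈ H∞`, and `T ∘ v` has a simple zero at `0`.
Each order is `≥ 1` (isolated zeros of analytic germs, the sphere not lying in `H∞`), the first
index set is finite (`helper_sphereWedgeZerosFinite`), and an analytic zero of order `1` is simple.
[cite: McDuffSalamon2012, §2.6, App. E (positivity of local intersection numbers)] -/
theorem helper_countOneStructure : ∀ (X : Type) [TopologicalSpace X] [ChartedSpace (EuclideanSpace ℝ (Fin 4)) X] [IsManifold (𝓡 4) ∞ X] (JX : ∀ y : X, TangentSpace (𝓡 4) y →L[ℝ] TangentSpace (𝓡 4) y) (T : X → ℂ) (U : Set X) (u v : ℂ → X), IsOpen U → ContMDiffOn (𝓡 4) 𝓘(ℝ, ℂ) ∞ T U → (∀ y ∈ U, ∀ w : TangentSpace (𝓡 4) y, (show ℂ from mfderiv (𝓡 4) 𝓘(ℝ, ℂ) T y (JX y w)) = Complex.I * (show ℂ from mfderiv (𝓡 4) 𝓘(ℝ, ℂ) T y w)) → IsClosed {y : X | y ∈ U ∧ T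 y = 0} → ContMDiff 𝓘(ℝ, ℂ) (𝓡 4) ∞ u → ContMDiff 𝓘(ℝ, ℂ) (𝓡 4) ∞ v → (∀ z : ℂ, z ≠ 0 → v z = u z⁻¹) → IsJHolomorphic (𝓡 4) JX u → IsJHolomorphic (𝓡 4) JX v → (∃ z : ℂ, ¬ (u z ∈ U ∧ T (u z) = 0)) → (∑ᶠ z ∈ {z : ℂ | u z ∈ U ∧ T (u z) = 0}, (meromorphicOrderAt (T ∘ u) z).untop₀) + (∑ᶠ w ∈ {w : ℂ | w = 0 ∧ v w ∈ U ∧ T (v w) = 0}, (meromorphicOrderAt (T ∘ v) w).untop₀) = 1 → (∃ z₀ : ℂ, (u z₀ ∈ U ∧ T (u z₀) = 0) ∧ (∀ z : ℂ, u z ∈ U ∧ T (u z) = 0 → z = z₀) ∧ ¬ (v 0 ∈ U ∧ T (v 0) = 0) ∧ deriv (T ∘ u) z₀ ≠ 0) ∨ ((∀ z : ℂ, ¬ (u z ∈ U ∧ T (u z) = 0)) ∧ (v 0 ∈ U ∧ T (v 0) = 0) ∧ deriv (T ∘ v) 0 ≠ 0) := by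
  intro X _ _ _ JX T U u v hU hT hTJ hcl hu hv huv hJu hJv hex hcount
  have huc : Continuous u := hu.continuous
  have hvc : Continuous v := hv.continuous
  have hO : IsOpen (u ⁻¹' U) := hU.preimage huc
  have hV : IsOpen (v ⁻¹' U) := hU.preimage hvc
  -- `f = T ∘ u` and `g = T ∘ v` are holomorphic on the preimages of `U`
  have hf : AnalyticOnNhd ℂ (T ∘ u) (u ⁻¹' U) :=
    (helper_holCoordCompJHol X JX T U u hU hT hTJ hu hJu).analyticOnNhd hO
  have hg : AnalyticOnNhd ℂ (T ∘ v) (v ⁻¹' U) :=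
    (helper_holCoordCompJHol X JX T U v hU hT hTJ hv hJv).analyticOnNhd hV
  -- the zero set `Z = {z | u z ∈ H∞}` is closed, finite, and has empty interior
  have hZcl : IsClosed {z : ℂ | u z ∈ U ∧ T (u z) = 0} := hcl.preimage huc
  have hfin : {z : ℂ | u z ∈ U ∧ T (u z) = 0}.Finite :=
    helper_sphereWedgeZerosFinite X JX T U u v hU hT hTJ hcl hu hv huv hJu hJv hex
  have hint : interior {z : ℂ | u z ∈ U ∧ T (u z) = 0} = ∅ :=
    interior_zeroSet_eq_empty (f := T ∘ u) (O := u ⁻¹' U) hO hf hZcl hex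
  -- every `u`-summand is `≥ 1`
  have hA1 : ∀ z ∈ {z : ℂ | u z ∈ U ∧ T (u z) = 0},
      1 ≤ (meromorphicOrderAt (T ∘ u) z).untop₀ := fun z hz =>
    one_le_untop₀_meromorphicOrderAt_of_eventually_ne_zero (hf z hz.1) hz.2
      (eventually_ne_zero_of_interior_zeroSet_eq_empty (f := T ∘ u) (O := u ⁻¹' U)
        hO hf hint hz.1)
  -- hence the `u`-sum dominates the number of zeros
  have hcard : ((hfin.toFinset.card : ℕ) : ℤ) ≤
      ∑ᶠ z ∈ {z : ℂ | u z ∈ U ∧ T (u z) = 0}, (meromorphicOrderAt (T ∘ u) z).untop₀ := by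
    rw [finsum_mem_eq_finite_toFinset_sum _ hfin]
    have h := Finset.card_nsmul_le_sum hfin.toFinset
      (fun z => (meromorphicOrderAt (T ∘ u) z).untop₀) 1
      (fun z hz => hA1 z (hfin.mem_toFinset.mp hz))
    simpa using h
  by_cases h0 : v 0 ∈ U ∧ T (v 0) = 0
  · -- the point at infinity lies on `H∞`: the `v`-sum is a single term `≥ 1`
    right
    have hset : {w : ℂ | w = 0 ∧ v w ∈ U ∧ T (v w) = 0} = {0} := by
      ext w
      simp only [mem_setOf_eq, mem_singleton_iff]
      exact ⟨fun h => h.1, fun h => ⟨h, h.symm ▸ h0⟩⟩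
    -- `g` is not identically zero near `0`: otherwise `Z` would contain a neighbourhood of
    -- infinity, impossible for a finite set
    have hne : ∀ᶠ w in 𝓝[≠] (0 : ℂ), (T ∘ v) w ≠ 0 := by
      rcases (hg 0 h0.1).eventually_eq_zero_or_eventually_ne_zero with h4 | h4
      · exfalso
        have h5 : ∀ᶠ w in 𝓝[≠] (0 : ℂ), w⁻¹ ∈ {z : ℂ | u z ∈ U ∧ T (u z) = 0} := by
          have h4' : ∀ᶠ w in 𝓝[≠] (0 : ℂ), (T ∘ v) w = 0 ∧ v w ∈ U :=
            nhdsWithin_le_nhds (h4.and (hV.mem_nhds h0.1))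
          filter_upwards [h4', self_mem_nhdsWithin] with w hw hw0
          show u w⁻¹ ∈ U ∧ T (u w⁻¹) = 0
          rw [← huv w hw0]
          exact ⟨hw.2, hw.1⟩
        have h6 : ∀ᶠ z in cobounded ℂ, z ∈ {z : ℂ | u z ∈ U ∧ T (u z) = 0} := by
          simpa only [inv_inv] using Filter.tendsto_inv₀_cobounded'.eventually h5
        have h7 : ∀ᶠ z in cobounded ℂ, z ∉ {z : ℂ | u z ∈ U ∧ T (u z) = 0} :=
          isBounded_def.mp hfin.isBounded
        obtain ⟨z, hz, hz'⟩ := (h6.and h7).exists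
        exact hz' hz
      · exact h4
    have hB1 : 1 ≤ (meromorphicOrderAt (T ∘ v) 0).untop₀ :=
      one_le_untop₀_meromorphicOrderAt_of_eventually_ne_zero (hg 0 h0.1) h0.2 hne
    have hBeq : ∑ᶠ w ∈ {w : ℂ | w = 0 ∧ v w ∈ U ∧ T (v w) = 0},
        (meromorphicOrderAt (T ∘ v) w).untop₀ = (meromorphicOrderAt (T ∘ v) 0).untop₀ := by
      rw [hset, finsum_mem_singleton]
    rw [hBeq] at hcount
    -- so the `u`-sum vanishes, `Z` is empty, and the order of `g` at `0` is exactly `1`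
    have hcard0 : hfin.toFinset.card = 0 := by
      have h : ((hfin.toFinset.card : ℕ) : ℤ) ≤ 0 := by linarith
      exact_mod_cast Nat.eq_zero_of_le_zero (by exact_mod_cast h)
    have hZ : {z : ℂ | u z ∈ U ∧ T (u z) = 0} = ∅ :=
      Set.Finite.toFinset_eq_empty.mp (Finset.card_eq_zero.mp hcard0)
    have hA0 : ∑ᶠ z ∈ {z : ℂ | u z ∈ U ∧ T (u z) = 0},
        (meromorphicOrderAt (T ∘ u) z).untop₀ = 0 := by
      rw [hZ, finsum_mem_empty]
    have hB : (meromorphicOrderAt (T ∘ v) 0).untop₀ = 1 := by linarith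
    refine ⟨fun z hz => ?_, h0, deriv_ne_zero_of_untop₀_meromorphicOrderAt_eq_one (hg 0 h0.1) hB⟩
    have hz' : z ∈ {z : ℂ | u z ∈ U ∧ T (u z) = 0} := hz
    rw [hZ] at hz'
    exact hz'
  · -- the point at infinity is off `H∞`: the `v`-sum is empty and the `u`-sum equals `1`
    left
    have hset : {w : ℂ | w = 0 ∧ v w ∈ U ∧ T (v w) = 0} = ∅ := by
      ext w
      simp only [mem_setOf_eq, mem_empty_iff_false, iff_false, not_and]
      rintro rfl
      exact fun h1 h2 => h0 ⟨h1, h2⟩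
    have hBeq : ∑ᶠ w ∈ {w : ℂ | w = 0 ∧ v w ∈ U ∧ T (v w) = 0},
        (meromorphicOrderAt (T ∘ v) w).untop₀ = 0 := by
      rw [hset, finsum_mem_empty]
    rw [hBeq, add_zero] at hcount
    -- `Z` is non-empty (the sum is non-zero) and has at most one element (the sum is `≥ #Z`)
    have hZne : {z : ℂ | u z ∈ U ∧ T (u z) = 0}.Nonempty := by
      by_contra hZ
      rw [Set.not_nonempty_iff_eq_empty] at hZ
      rw [hZ, finsum_mem_empty] at hcount
      exact zero_ne_one hcount
    obtain ⟨z₀, hz₀⟩ := hZne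
    have hcard1 : hfin.toFinset.card ≤ 1 := by
      have h : ((hfin.toFinset.card : ℕ) : ℤ) ≤ 1 := hcard.trans hcount.le
      exact_mod_cast h
    have huniq : ∀ z : ℂ, u z ∈ U ∧ T (u z) = 0 → z = z₀ := fun z hz =>
      Finset.card_le_one.mp hcard1 z (hfin.mem_toFinset.mpr hz) z₀ (hfin.mem_toFinset.mpr hz₀)
    -- so `Z = {z₀}` and the order of `f` at `z₀` is exactly `1`
    have hZ : {z : ℂ | u z ∈ U ∧ T (u z) = 0} = {z₀} := by
      ext z
      simp only [mem_singleton_iff]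
      exact ⟨huniq z, fun h => h ▸ hz₀⟩
    have hA : (meromorphicOrderAt (T ∘ u) z₀).untop₀ = 1 := by
      rw [hZ, finsum_mem_singleton] at hcount
      exact hcount
    exact ⟨z₀, hz₀, huniq, h0, deriv_ne_zero_of_untop₀_meromorphicOrderAt_eq_one (hf z₀ hz₀.1) hA⟩

end Summit.SmoothPoincare4.SmoothPoincare4.Theorems.GromovRecognitionRelEnd.CrossCapLaurent
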